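import Summits.Parity.GeneralizedHardyLittlewood.Theses.LiouvilleShiftedTables
import Summits.Parity.GeneralizedHardyLittlewood.Theorems.DilatedTableChowla.Negative.DilatedTableChowlaBlocks
import Summits.Parity.GeneralizedHardyLittlewood.Theorems.DilatedTableChowla.Negative.DilatedTableChowlaOffDiagonal
import Summits.Parity.GeneralizedHardyLittlewood.Theorems.DilatedTableChowla.Negative.DilatedTableChowlaPointwise
import Summits.Parity.GeneralizedHardyLittlewood.Theorems.LiouvilleShiftedTablesLargeDilatedTableChowlaPointwise

/-!
# `DilatedTableChowla` (stmt-Parity-14271): the fixed-residue face of the LARGE-DILATION BAND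

Support file for the crux `LiouvilleShiftedTables.DilatedTableChowla` (X1) and its band item
`LargeDilatedTableChowla` (stmt-Parity-14839); notation `L`, `rows`, `cols`, `S`, `F` of
`Theorems/DilatedTableChowla/Negative/DilatedTableChowlaBlocks`.

Known (kernel-checked): `DilatedTableChowla ↔ TableChowla ∧ LargeDilatedTableChowla`
(`LargeDilatedTableChowla.dilatedTableChowla_iff_table_and_item`), and the `q = 1` half `TableChowla`
contains the fixed-residue level-of-distribution face for `λ` at every level `θ ∈ [7/12, 1)`
(`TableChowla.Negative.fixedResidueFace_of_tableChowla`, `…EveryLevelFaces`), a statement of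
Elliott–Halberstam species beyond the reach of GRH.  This file shows that the OTHER half — the band
`(log x)^K < q ≤ x^{δ/2}`, so far described only as "the genuinely q-aspect content (large sieve /
dispersion in q, Matomäki–Radziwiłł in progressions)" with the item-prover's verdict "no q-aspect
two-point theorem in print" — carries a face of the same species:

* `colFace_pow_four_le` (two Cauchy–Schwarz steps, any block):
  `(Σ_{b ∈ cols} |Σ_{a ∈ rows} λ(ab+c)|)⁴ ≤ #rows² · #cols² · F(q,u,v)`.
* `bandFace_of_largeDilatedTableChowla`: the band item implies, for every `c ≠ 0`, `0 < δ ≤ 1/12`,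
  `C > 0`, some `K`, `x₀` such that for `x ≥ x₀`, every `A ∈ [x^δ, x^{1/3+δ}]`, all class functions
  `u v`, off an exceptional set `E'` of dilations of harmonic mass `≤ (log x)^{-C}`, at EVERY band
  dilation `(log x)^K < q ≤ x^{δ/2}`, `q ∉ E'`:
  `Σ_{b ≤ x/A, b ≡ v q (q)} |Σ_{A < a ≤ 2A, a ≡ u q (q)} λ(ab+c)| ≤ 3 (x/q²)/(log x)^C`,
  a `(log x)^C` saving over the trivial `#rows·#cols ≤ 6x/q²` of that block.
* `bandFace_dvd_of_largeDilatedTableChowla`: the class `u q = 0`, i.e. `q ∣ a`.  Then `n = ab + c`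
  runs over the residue class `c (mod q·b)` in `(Ab + c, 2Ab + c]`, `≍ A/q ≥ x^{δ/2}/2` terms per
  modulus: the
  band item contains FIXED-RESIDUE (`c`) equidistribution of `λ` to the moduli `m = q·b`,
  `b ≤ x/A`, `b ≡ v (q)`, in `ℓ¹` over `b`, with every log-power saving RELATIVE TO THAT THIN FAMILY'S
  OWN SIZE `x/q²`, for harmonically almost all `q` of the band.  Level: `m ≍ q·x/A`, segment length
  `≍ x`, so `θ = 1 − log A/log x + log q/log x ∈ [2/3 − δ/2, 1 − δ/2]` at `q ≍ x^{δ/2}` — beyond `1/2`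
  at EVERY point of the window, and GRH is idle throughout (segments of `A/q < x^{1/2}` terms in
  progressions of modulus `> x^{1/2}`).  The full-family fixed-residue conjecture
  `Σ_{m ≤ x^θ} |Σ_{n ≤ x, n ≡ c (m)} λ(n)| ≤ x/(log x)^C` does NOT imply it (the thin family
  `m ∈ q·ℕ` is a `1/q²`-fraction of the trivial mass, `q` a power of `x`); Bombieri–Vinogradov for
  `λ` (level `1/2`, Fouvry–Tenenbaum = route support `BVLiouville`) and the variance-over-classes
  theorems of Klurman–Mangerel–Teräväinen (doi:10.1112/plms.12546) do not touch fixed residues at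
  these levels.
* `face_of_dilatedTableChowla`: the same face from the crux itself at every dilation
  `1 ≤ q ≤ x^{δ/2}` off a sparse set (via `Negative.crux_imp_pointwiseOffSparse`); its `q = 1`
  instance is the `TableChowla` face, its band instances are the above.

Consequence for the planners: BOTH halves of `DilatedTableChowla ↔ TableChowla ∧
LargeDilatedTableChowla` contain fixed-residue distribution of `λ` beyond level `1/2` with arbitrary
log-power savings, beyond GRH; the residual item stmt-Parity-14839 is conjecture-grade by a
certificate of the same species as stmt-Parity-14270's (there: the full modulus family at levels
`[7/12, 1)`; here: the thin families `m ∈ q·ℕ` at levels `[2/3 − δ/2, 1 − δ/2]`, with precision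
relative to the family), not merely tool-less.  In print, fixed-residue `ℓ¹` distribution of `λ`/`μ`
stops at level `1/2` (composite moduli; Fouvry–Tenenbaum) and `1/2 + 1/78` (prime moduli, `o(1)`
saving; Green, arXiv:1604.04481).  All statements are in the crux's own vocabulary (no new
definitions). [folklore]
-/

namespace Summit.Parity.GeneralizedHardyLittlewood.Theorems.DilatedTableChowla.FixedResidueBand

open Finset
open Summit.Parity.GeneralizedHardyLittlewood.Theses.LiouvilleShiftedTables
open Summit.Parity.GeneralizedHardyLittlewood.Theorems.DilatedTableChowla.Negative

/-! ### The block inequality: column-sum face ≤ fourth moment -/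

/-- For every block, `Σ_b (Σ_a λ(ab+c))² = Σ_{a,a'} S(a,a')` (expand the square and swap sums).
[folklore] -/
theorem sum_colSum_sq_eq (c : ℤ) (x A : ℝ) (q u v : ℕ) :
    ∑ b ∈ cols x A q v, (∑ a ∈ rows A q u, L ((a : ℤ) * b + c)) ^ 2 =
      ∑ a ∈ rows A q u, ∑ a' ∈ rows A q u, S c x A q v a a' := by
  have hsq : ∀ b : ℕ, (∑ a ∈ rows A q u, L ((a : ℤ) * b + c)) ^ 2 =
      ∑ a ∈ rows A q u, ∑ a' ∈ rows A q u, L ((a : ℤ) * b + c) * L ((a' : ℤ) * b + c) := by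
    intro b
    rw [sq, Finset.sum_mul_sum]
  simp_rw [hsq]
  rw [Finset.sum_comm]
  refine Finset.sum_congr rfl fun a _ => ?_
  rw [Finset.sum_comm]
  rfl

/-- `(Σ_{a,a'} S(a,a'))² ≤ #rows² · F` (Cauchy–Schwarz over the `#rows²` pairs). [folklore] -/
theorem sq_sum_S_le (c : ℤ) (x A : ℝ) (q u v : ℕ) :
    (∑ a ∈ rows A q u, ∑ a' ∈ rows A q u, S c x A q v a a') ^ 2 ≤
      ((rows A q u).card : ℝ) ^ 2 * F c x A q u v := by
  calc (∑ a ∈ rows A q u, ∑ a' ∈ rows A q u, S c x A q v a a') ^ 2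
      ≤ ((rows A q u).card : ℝ) * ∑ a ∈ rows A q u, (∑ a' ∈ rows A q u, S c x A q v a a') ^ 2 :=
        sq_sum_le_card_mul_sum_sq
    _ ≤ ((rows A q u).card : ℝ) *
          ∑ a ∈ rows A q u, (((rows A q u).card : ℝ) * ∑ a' ∈ rows A q u, (S c x A q v a a') ^ 2) := by
        gcongr with a _
        exact sq_sum_le_card_mul_sum_sq
    _ = ((rows A q u).card : ℝ) ^ 2 * F c x A q u v := by
        unfold F
        rw [← Finset.mul_sum]
        ring

/-- **THE BLOCK INEQUALITY.** For every block `(q;u,v)` of the crux,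
`(Σ_{b ∈ cols} |Σ_{a ∈ rows} λ(ab+c)|)⁴ ≤ #rows² · #cols² · F(q,u,v)`: the column-sum (fixed-residue)
face is controlled by the fourth moment (two Cauchy–Schwarz steps; equivalently
`‖Mᵀ𝟙‖₁ ≤ √(#rows #cols) ‖M‖_{S⁴}`). [folklore] -/
theorem colFace_pow_four_le (c : ℤ) (x A : ℝ) (q u v : ℕ) :
    (∑ b ∈ cols x A q v, |∑ a ∈ rows A q u, L ((a : ℤ) * b + c)|) ^ 4 ≤
      ((rows A q u).card : ℝ) ^ 2 * ((cols x A q v).card : ℝ) ^ 2 * F c x A q u v := by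
  have h1 : (∑ b ∈ cols x A q v, |∑ a ∈ rows A q u, L ((a : ℤ) * b + c)|) ^ 2 ≤
      ((cols x A q v).card : ℝ) *
        ∑ b ∈ cols x A q v, (∑ a ∈ rows A q u, L ((a : ℤ) * b + c)) ^ 2 := by
    have := sq_sum_le_card_mul_sum_sq (s := cols x A q v)
      (f := fun b => |∑ a ∈ rows A q u, L ((a : ℤ) * b + c)|)
    simpa only [sq_abs] using this
  have h0 : 0 ≤ ∑ b ∈ cols x A q v, |∑ a ∈ rows A q u, L ((a : ℤ) * b + c)| :=
    Finset.sum_nonneg fun b _ => abs_nonneg _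
  calc (∑ b ∈ cols x A q v, |∑ a ∈ rows A q u, L ((a : ℤ) * b + c)|) ^ 4
      = ((∑ b ∈ cols x A q v, |∑ a ∈ rows A q u, L ((a : ℤ) * b + c)|) ^ 2) ^ 2 := by ring
    _ ≤ (((cols x A q v).card : ℝ) *
          ∑ b ∈ cols x A q v, (∑ a ∈ rows A q u, L ((a : ℤ) * b + c)) ^ 2) ^ 2 := by
        gcongr
    _ = ((cols x A q v).card : ℝ) ^ 2 *
          (∑ a ∈ rows A q u, ∑ a' ∈ rows A q u, S c x A q v a a') ^ 2 := by
        rw [sum_colSum_sq_eq]; ring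
    _ ≤ ((cols x A q v).card : ℝ) ^ 2 * (((rows A q u).card : ℝ) ^ 2 * F c x A q u v) := by
        gcongr
        exact sq_sum_S_le c x A q u v
    _ = _ := by ring

/-! ### From a pointwise block bound to the face -/

/-- Arithmetic of the window: if `1 ≤ q ≤ x^{δ/2}`, `A` is in the window, `x ≥ 1`, `log x ≥ 1` and
`q⁴ F(q,u,v) ≤ x²/(log x)^{4C}`, then the column-sum face of the block is `≤ 3 (x/q²)/(log x)^C`
(`#rows ≤ 3A/q`, `#cols ≤ 2x/(Aq)` from `Negative.window_counts`, the block inequality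
`colFace_pow_four_le`, and a fourth root using `36 ≤ 3⁴`). [folklore] -/
theorem colFace_le_of_pointwise {c : ℤ} {δ x A C : ℝ} (hδ : 0 < δ) (hδ' : δ ≤ 1 / 12)
    (hx1 : 1 ≤ x) (hlog : 1 ≤ Real.log x) (hA1 : x ^ δ ≤ A) (hA2 : A ≤ x ^ (1 / 3 + δ)) {q : ℕ}
    (hq1 : 1 ≤ q) (hq2 : q ≤ ⌊x ^ (δ / 2)⌋₊) (u v : ℕ)
    (hF : (q : ℝ) ^ 4 * F c x A q u v ≤ x ^ 2 / Real.log x ^ (4 * C)) :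
    (∑ b ∈ cols x A q v, |∑ a ∈ rows A q u, L ((a : ℤ) * b + c)|) ≤
      3 * (x / (q : ℝ) ^ 2) / Real.log x ^ C := by
  obtain ⟨hr, hcl, -, -, -, h1A⟩ := window_counts hδ hδ' hx1 hA1 hA2 hq1 hq2 u v
  have hqpos : (0 : ℝ) < q := by exact_mod_cast hq1
  have hqne : (q : ℝ) ≠ 0 := hqpos.ne'
  have hApos : 0 < A := by linarith
  have hxpos : 0 < x := by linarith
  have hlogpos : 0 < Real.log x := by linarith
  set Lg : ℝ := Real.log x ^ C with hLg
  have hLgpos : 0 < Lg := Real.rpow_pos_of_pos hlogpos C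
  have hLgne : Lg ≠ 0 := hLgpos.ne'
  have hpow : Real.log x ^ (4 * C) = Lg ^ 4 := by
    have h4 : (4 : ℝ) * C = C * ((4 : ℕ) : ℝ) := by push_cast; ring
    rw [h4, Real.rpow_mul_natCast hlogpos.le]
  have hP : (q : ℝ) ^ 4 * F c x A q u v ≤ x ^ 2 / Lg ^ 4 := by rwa [hpow] at hF
  have hF0 : 0 ≤ F c x A q u v := F_nonneg c x A q u v
  have hRC : ((rows A q u).card : ℝ) * ((cols x A q v).card : ℝ) ≤ 6 * x / (q : ℝ) ^ 2 := by
    calc ((rows A q u).card : ℝ) * ((cols x A q v).card : ℝ)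
        ≤ (3 * A / q) * (2 * x / (A * q)) :=
          mul_le_mul hr hcl (Nat.cast_nonneg _) (by positivity)
      _ = 6 * x / (q : ℝ) ^ 2 := by
          field_simp
          norm_num
  have ht0 : 0 ≤ 3 * (x / (q : ℝ) ^ 2) / Lg := by positivity
  refine le_of_pow_le_pow_left₀ (by norm_num : (4 : ℕ) ≠ 0) ht0 ?_
  calc (∑ b ∈ cols x A q v, |∑ a ∈ rows A q u, L ((a : ℤ) * b + c)|) ^ 4
      ≤ ((rows A q u).card : ℝ) ^ 2 * ((cols x A q v).card : ℝ) ^ 2 * F c x A q u v :=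
        colFace_pow_four_le c x A q u v
    _ = (((rows A q u).card : ℝ) * ((cols x A q v).card : ℝ)) ^ 2 * F c x A q u v := by ring
    _ ≤ (6 * x / (q : ℝ) ^ 2) ^ 2 * F c x A q u v := by gcongr
    _ = 36 * (x ^ 2 / (q : ℝ) ^ 8) * ((q : ℝ) ^ 4 * F c x A q u v) := by
        field_simp
        ring
    _ ≤ 36 * (x ^ 2 / (q : ℝ) ^ 8) * (x ^ 2 / Lg ^ 4) := by gcongr
    _ ≤ 81 * (x ^ 2 / (q : ℝ) ^ 8) * (x ^ 2 / Lg ^ 4) := by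
        have h0 : 0 ≤ (x ^ 2 / (q : ℝ) ^ 8) * (x ^ 2 / Lg ^ 4) := by positivity
        nlinarith
    _ = (3 * (x / (q : ℝ) ^ 2) / Lg) ^ 4 := by
        field_simp
        ring

/-! ### The faces -/

/-- **THE FIXED-RESIDUE FACE OF THE BAND ITEM (stmt-Parity-14839).**  `LargeDilatedTableChowla`
implies: for every `c ≠ 0`, `0 < δ ≤ 1/12`, `C > 0` there are `K`, `x₀` such that for `x ≥ x₀`, every
`A ∈ [x^δ, x^{1/3+δ}]` and all class functions `u v` there is an exceptional set `E'` of dilations of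
harmonic mass `≤ (log x)^{-C}` such that at EVERY band dilation `(log x)^K < q ≤ x^{δ/2}` off `E'`
`Σ_{b ≤ x/A, b ≡ v q (q)} |Σ_{A < a ≤ 2A, a ≡ u q (q)} λ(ab+c)| ≤ 3(x/q²)/(log x)^C` — a `(log x)^C`
saving over the block's own trivial size `≤ 6x/q²`.  For fixed `b` the inner sum is `λ` on the
progression `n ≡ u q·b + c (mod q·b)`, `n ∈ (Ab, 2Ab]`, of `≍ A/q` terms and modulus `q·b ≍ q·x/A`,
i.e. level `1 − log A/log x + log q/log x ∈ [2/3 − δ/2, 1 − δ/2]` for `q ≍ x^{δ/2}`: beyond `1/2`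
(and beyond GRH, the segments having `< x^{1/2}` terms) at every point of the window.  Proof: the
item's pointwise form (`LargeDilatedTableChowla.item_imp_bandPointwise`) at exponent `4C`, then
`colFace_le_of_pointwise`. [folklore] -/
theorem bandFace_of_largeDilatedTableChowla (h : LargeDilatedTableChowla) :
    ∀ c : ℤ, c ≠ 0 → ∀ δ : ℝ, 0 < δ → δ ≤ 1 / 12 → ∀ C : ℝ, 0 < C → ∃ K : ℕ, ∃ x₀ : ℝ,
      ∀ x : ℝ, x₀ ≤ x → ∀ A : ℝ, x ^ δ ≤ A → A ≤ x ^ (1 / 3 + δ) → ∀ u v : ℕ → ℕ,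
        ∃ E' : Finset ℕ, (∑ q ∈ E', ((q : ℝ))⁻¹) ≤ (Real.log x ^ C)⁻¹ ∧
          ∀ q : ℕ, ⌊Real.log x ^ K⌋₊ < q → q ≤ ⌊x ^ (δ / 2)⌋₊ → q ∉ E' →
            (∑ b ∈ cols x A q (v q), |∑ a ∈ rows A q (u q), L ((a : ℤ) * b + c)|) ≤
              3 * (x / (q : ℝ) ^ 2) / Real.log x ^ C := by
  intro c hc δ hδ hδ' C hC
  obtain ⟨K, x₀, hx₀⟩ :=
    Summit.Parity.GeneralizedHardyLittlewood.Theorems.LargeDilatedTableChowla.item_imp_bandPointwise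
      h c hc δ hδ hδ' (4 * C) (by positivity)
  refine ⟨K, max x₀ 8, fun x hx A hA1 hA2 u v => ?_⟩
  have hx₀x : x₀ ≤ x := le_trans (le_max_left _ _) hx
  have hx8 : 8 ≤ x := le_trans (le_max_right _ _) hx
  have hx1 : 1 ≤ x := by linarith
  have hlog : 1 ≤ Real.log x := by have := two_le_log_of_ge_eight hx8; linarith
  obtain ⟨E', hE', hq⟩ := hx₀ x hx₀x A hA1 hA2 u v
  refine ⟨E', hE'.trans ?_, fun q hqK hqx hqE => ?_⟩
  · exact inv_anti₀ (Real.rpow_pos_of_pos (by linarith) C)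
      (Real.rpow_le_rpow_of_exponent_le hlog (by linarith))
  · have hq1 : 1 ≤ q := by omega
    exact colFace_le_of_pointwise hδ hδ' hx1 hlog hA1 hA2 hq1 hqx (u q) (v q) (hq q hqK hqx hqE)

/-- **The class `u q = 0` (`q ∣ a`), verbatim: fixed residue `c` modulo `q·b`.**  The band item
implies, off a harmonically `(log x)^{-C}`-sparse set of band dilations `q`, for every column class
function `v`:
`Σ_{b ≤ x/A, b ≡ v q (q)} |Σ_{A < a ≤ 2A, q ∣ a} λ(ab + c)| ≤ 3(x/q²)/(log x)^C`.
Here `{ab + c : A < a ≤ 2A, q ∣ a}` is the residue class `c (mod q·b)` in `(Ab + c, 2Ab + c]`: this is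
fixed-residue equidistribution of `λ` to the moduli `m = q·b ≤ q·x/A` (level up to `1 − δ/2`), in `ℓ¹`
over the thin family `b ≤ x/A`, `b ≡ v q (mod q)`, with every log-power saving relative to the
family's own size — for harmonically almost every `q` of the band. [folklore] -/
theorem bandFace_dvd_of_largeDilatedTableChowla (h : LargeDilatedTableChowla) :
    ∀ c : ℤ, c ≠ 0 → ∀ δ : ℝ, 0 < δ → δ ≤ 1 / 12 → ∀ C : ℝ, 0 < C → ∃ K : ℕ, ∃ x₀ : ℝ,
      ∀ x : ℝ, x₀ ≤ x → ∀ A : ℝ, x ^ δ ≤ A → A ≤ x ^ (1 / 3 + δ) → ∀ v : ℕ → ℕ,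
        ∃ E' : Finset ℕ, (∑ q ∈ E', ((q : ℝ))⁻¹) ≤ (Real.log x ^ C)⁻¹ ∧
          ∀ q : ℕ, ⌊Real.log x ^ K⌋₊ < q → q ≤ ⌊x ^ (δ / 2)⌋₊ → q ∉ E' →
            (∑ b ∈ (Finset.Icc 1 ⌊x / A⌋₊).filter (fun b : ℕ => b ≡ v q [MOD q]),
              |∑ a ∈ (Finset.Ioc ⌊A⌋₊ ⌊2 * A⌋₊).filter (fun a : ℕ => q ∣ a),
                (ArithmeticFunction.liouville (Int.toNat ((a : ℤ) * b + c)) : ℝ)|) ≤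
              3 * (x / (q : ℝ) ^ 2) / Real.log x ^ C := by
  intro c hc δ hδ hδ' C hC
  obtain ⟨K, x₀, hx₀⟩ := bandFace_of_largeDilatedTableChowla h c hc δ hδ hδ' C hC
  refine ⟨K, x₀, fun x hx A hA1 hA2 v => ?_⟩
  obtain ⟨E', hE', hq⟩ := hx₀ x hx A hA1 hA2 (fun _ => 0) v
  refine ⟨E', hE', fun q hqK hqx hqE => ?_⟩
  have key := hq q hqK hqx hqE
  have hrows : (Finset.Ioc ⌊A⌋₊ ⌊2 * A⌋₊).filter (fun a : ℕ => q ∣ a) = rows A q 0 := by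
    unfold rows
    exact Finset.filter_congr fun a _ => (Nat.modEq_zero_iff_dvd).symm
  rw [hrows]
  simpa only [cols, L] using key

/-- **The same face from the crux, at every dilation.**  `DilatedTableChowla` implies, for every
`c ≠ 0`, `0 < δ ≤ 1/12`, `C > 0` and `x ≥ x₀`, `A` in the window, all `u v`, off an exceptional set of
dilations of harmonic mass `≤ (log x)^{-C}`, at EVERY `1 ≤ q ≤ x^{δ/2}` outside it:
`Σ_{b ≤ x/A, b ≡ v q (q)} |Σ_{A < a ≤ 2A, a ≡ u q (q)} λ(ab+c)| ≤ 3(x/q²)/(log x)^C`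
(via `Negative.crux_imp_pointwiseOffSparse`).  At `q = 1` (never exceptional once `(log x)^C > 1`)
this is the `TableChowla` face `Σ_{b ≤ x/A} |Σ_{a ∼ A} λ(ab+c)| ≤ 3x/(log x)^C` (fixed residue `c`,
level `1 − log A/log x ∈ [7/12, 1)`); in the band it is `bandFace_of_largeDilatedTableChowla`.
[folklore] -/
theorem face_of_dilatedTableChowla (h : DilatedTableChowla) :
    ∀ c : ℤ, c ≠ 0 → ∀ δ : ℝ, 0 < δ → δ ≤ 1 / 12 → ∀ C : ℝ, 0 < C → ∃ x₀ : ℝ,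
      ∀ x : ℝ, x₀ ≤ x → ∀ A : ℝ, x ^ δ ≤ A → A ≤ x ^ (1 / 3 + δ) → ∀ u v : ℕ → ℕ,
        ∃ E' : Finset ℕ, (∑ q ∈ E', ((q : ℝ))⁻¹) ≤ (Real.log x ^ C)⁻¹ ∧
          ∀ q : ℕ, 1 ≤ q → q ≤ ⌊x ^ (δ / 2)⌋₊ → q ∉ E' →
            (∑ b ∈ cols x A q (v q), |∑ a ∈ rows A q (u q), L ((a : ℤ) * b + c)|) ≤
              3 * (x / (q : ℝ) ^ 2) / Real.log x ^ C := by
  intro c hc δ hδ hδ' C hC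
  obtain ⟨x₀, hx₀⟩ := crux_imp_pointwiseOffSparse h c hc δ hδ hδ' (4 * C) (by positivity)
  refine ⟨max x₀ 8, fun x hx A hA1 hA2 u v => ?_⟩
  have hx₀x : x₀ ≤ x := le_trans (le_max_left _ _) hx
  have hx8 : 8 ≤ x := le_trans (le_max_right _ _) hx
  have hx1 : 1 ≤ x := by linarith
  have hlog : 1 ≤ Real.log x := by have := two_le_log_of_ge_eight hx8; linarith
  obtain ⟨E', hE', hq⟩ := hx₀ x hx₀x A hA1 hA2 u v
  refine ⟨E', hE'.trans ?_, fun q hq1 hqx hqE => ?_⟩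
  · exact inv_anti₀ (Real.rpow_pos_of_pos (by linarith) C)
      (Real.rpow_le_rpow_of_exponent_le hlog (by linarith))
  · exact colFace_le_of_pointwise hδ hδ' hx1 hlog hA1 hA2 hq1 hqx (u q) (v q) (hq q hq1 hqx hqE)

end Summit.Parity.GeneralizedHardyLittlewood.Theorems.DilatedTableChowla.FixedResidueBand
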